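import Summits.SmoothPoincare4.SmoothPoincare4.Theses.EinsteinBulk
import Summits.SmoothPoincare4.SmoothPoincare4.Theorems.InformationMetricHadamardAhHadamardFillingEbtReduction
import Summits.SmoothPoincare4.SmoothPoincare4.Theorems.InformationMetricHadamardC0AhRecognition

/-!
# `EinsteinBulk.HadamardFillingStandard` (item stmt-SmoothPoincare4-8000)

A closed smooth `M ≃ₕ S⁴` that is the conformal infinity of a `C²`-conformally compact,
boundary-normalised 5-manifold `(N, g)` with `Rm ≤ 0` on orthonormal pairs is diffeomorphic to `S⁴`.
Proof: the compactification collar of line `einstein-bulk-transfer` of crux `AhHadamardFilling`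
(`stub_compactificationCollar`, landed) makes `(N, g)` a connected `sec ≤ 0` collar filling of the
homotopy 4-sphere `M` over `κ₀ g₀`; completeness, the closure clause and simple connectivity are
automatic (`UniversalCoverStripsTopology.*`, p124840); the `C⁰` recognition theorem of route
`InformationMetricHadamard` (`C0AhRecognition.CoreDistanceMorse.C0AhRecognition_of`) concludes.
-/

noncomputable section

-- the prescribed namespace `Summit.<P>.<Sub>.…` duplicates `SmoothPoincare4` (P = Sub)
set_option linter.dupNamespace false

open scoped Manifold ContDiff Topology ContinuousMap
open Set Function Bundle
open Literature.Topology.FourManifolds Literature.Geometry.Lorentzian Literature.Geometry.Riemannian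
open Summit.SmoothPoincare4.SmoothPoincare4.Theses
open Summit.SmoothPoincare4.SmoothPoincare4.Cruxes.AhHadamardFilling

namespace Summit.SmoothPoincare4.SmoothPoincare4.Theorems

/-- **`EinsteinBulk.HadamardFillingStandard`** (item stmt-SmoothPoincare4-8000): a closed smooth
`M ≃ₕ S⁴` bounding a `C²`-conformally compact boundary-normalised 5-manifold with `Rm ≤ 0` on
orthonormal pairs is diffeomorphic to `S⁴` — compactification collar, curvature-format bridge,
automatic completeness / closure clause / simple connectivity, and `C0AhRecognition_of`. -/
theorem HadamardFillingStandard_proof : EinsteinBulk.HadamardFillingStandard := by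
  intro M _ _ _ _ _ _ _ _ _ he g₀ N _ _ _ _ _ g _ hpack hK
  obtain ⟨o⟩ :=
    Literature.Topology.FourManifolds.isOrientable_of_homotopyEquiv_sphere_four_holds M he
  have hsec := EinsteinBulkTransfer.sectionalCurvature_nonpos_of_orthonormal_leviCivita N g hK
  obtain ⟨hconn, c', κ₀, Φ, hc', hκ₀, hsm, hinj, hco, hasym₀⟩ :=
    EinsteinBulkTransfer.stub_compactificationCollar M g₀ N g hpack
  haveI : ConnectedSpace N := hconn
  -- the scaled boundary metric and the asymptotics in its terms
  obtain ⟨gκ, hgκ, hgκv⟩ := EinsteinBulkTransfer.exists_scaledMetric hκ₀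
    (PseudoRiemannianMetric.ofRiemannian g₀) (PseudoRiemannianMetric.isRiemannian_ofRiemannian g₀)
  have hasym : ∀ ε : ℝ, 0 < ε → ∃ t ∈ Ioo (0 : ℝ) 1, ∀ (x : M) (l : ℝ), l ∈ Ioo (0 : ℝ) t →
      ∀ (v : TangentSpace (𝓡 4) x) (s : ℝ),
        |(PseudoRiemannianMetric.ofRiemannian g).val (Φ (x, l))
              (mfderiv ((𝓡 4).prod 𝓘(ℝ, ℝ)) (𝓡 5) Φ (x, l) (v, s))
              (mfderiv ((𝓡 4).prod 𝓘(ℝ, ℝ)) (𝓡 5) Φ (x, l) (v, s)) -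
            c' * (s ^ 2 + gκ.val x v v) / l ^ 2| ≤ ε * (c' * (s ^ 2 + gκ.val x v v) / l ^ 2) := by
    simpa only [hgκv, PseudoRiemannianMetric.val_ofRiemannian] using hasym₀
  -- the homotopy 4-sphere structure on `M`
  let S : HomotopySphere 4 := ⟨M, o, ⟨he⟩⟩
  have hcl := UniversalCoverStripsTopology.closure_image_far_subset_of_collar
    _ hgκ (PseudoRiemannianMetric.ofRiemannian g) (PseudoRiemannianMetric.isRiemannian_ofRiemannian g)
    Φ hc' hsm hinj hasym
  have hcpt := UniversalCoverStripsTopology.isCompact_setOf_edist_le_of_collar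
    _ hgκ (PseudoRiemannianMetric.ofRiemannian g) (PseudoRiemannianMetric.isRiemannian_ofRiemannian g)
    Φ hc' hsm hinj hasym hco
  haveI : SimplyConnectedSpace N :=
    UniversalCoverStripsTopology.simplyConnected_of_connectedCollarFilling S
      _ hgκ N (PseudoRiemannianMetric.ofRiemannian g) (PseudoRiemannianMetric.isRiemannian_ofRiemannian g)
      c' Φ hc' hsec hsm hinj hco hasym
  exact Summit.SmoothPoincare4.SmoothPoincare4.Cruxes.C0AhRecognition.CoreDistanceMorse.C0AhRecognition_of S
    _ hgκ N (PseudoRiemannianMetric.ofRiemannian g) (PseudoRiemannianMetric.isRiemannian_ofRiemannian g)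
    c' Φ hc' hcpt hsec hsm hinj hco hcl hasym

end Summit.SmoothPoincare4.SmoothPoincare4.Theorems

end
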